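import Summits.BirchSwinnertonDyer.Rank1Residual.X1.GeneratorSqueeze
import Summits.BirchSwinnertonDyer.Rank1Residual.X1.GeneratorBound
import Summits.BirchSwinnertonDyer.Rank1Residual.X1.ConstantTermSqueeze
import Summits.BirchSwinnertonDyer.Rank1Residual.Additive.CongruentPartnerBudgetSchema
import HarnessLib

/-!
# Route M IN THE KERNEL (layer 0): a generator COUNT `p^B ≤ #(X/𝔪X)` (TYPED) and the Newton data
# `(λ(g), v_p(g(0)))` of the `Λ`-divisors of `ϖ·L_p(E,T)` (TYPED) squeeze `λ_alg` through LEMMA M₀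

HONEST FRAMING (cell `b2b-bsdres`, run/shared/lean/b2b/bsd-rank1-residual/, verbatim in every
file): the goal of the cell is to DELETE the COMBINATION-SHAPED residual classes of the
Birch–Swinnerton-Dyer formula for ALL analytic-rank `≤ 1` elliptic curves over `ℚ` — "full BSD
formula for every rank `≤ 1` curve in class `C`" assembled STRICTLY from published theorems — so
that the rank-`≤ 1` remainder becomes exactly the CONSTRUCTION-SHAPED classes, which are TYPED
(missing-input `Prop`s), NOT attempted. This is not "finishing BSD". Sub-cell
`b2b-bsdres-eisenstein-p1` (CLASS-OWNERS row "X1 (r=0)"), gen 13: research route; NO CLAIM BEYOND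
STATED CLASSES; nothing here changes a label. TWO typed per-pair inputs (defs, nothing asserted);
everything else is a theorem over PUBLISHED named facts already in the tree (`hW16` Wuthrich 2014
Thm. 16, `h310` Greenberg Prop. 3.10, `hGr` Greenberg Thm. 4.1, `h414` Greenberg Prop. 4.14 /
Hachimori–Matsuno Cor. (i), `hmod` modularity, `hGZK` Gross–Zagier–Kolyvagin) and the cell's typed
inputs `NoFiniteSubmoduleAt` (n1011 schema (b′)), `AnalyticMuLE`, `AnalyticLambdaEq`,
`AlgebraicLambdaMem`.

WHY THIS FILE. Gen 12's route M (`X1/GeneratorSqueeze.lean`, X1R0-GAPMAP §21) typed its OUTPUT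
`AlgebraicLambdaMem W p A_M` ("`λ_alg ∈ A_M`") and certified `A_M` OUTSIDE the kernel from (i) a
generator count `d(X_j) ≥ B` (route T §14.1 (a)–(f) before Greenberg's inequality), (ii) LEMMA (M)
`d(X) ≤ ord_𝔪(char X)` — the ONE UNPRINTED STEP — and (iii) the Newton polygon of `ϖ·L_p`. Gen 13
puts (ii) in the kernel at layer 0 (`X1/GeneratorBound.lean`, LEMMA M₀:
`#(X/𝔪X) ≤ p^{v_p(f(0))}` for `X` f.g. torsion without nonzero finite submodules, `f(0) ≠ 0`), so the
kernel chain now STARTS at (i) and (iii):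

* (i) **`GeneratorCountGE W p B`** (TYPED, §1): `p^B ≤ #(X/𝔪X)` for every cyclotomic dual datum —
  in print-facing terms `dim_{𝔽_p} Sel_E(ℚ_∞)[p]^Γ ≥ B` (`X/𝔪X` is the Pontryagin dual of
  `Sel[p]^Γ = Sel^Γ[p]`); route T's count is `B = t_0(E) + a − 2δ` (§14.1), route D's `B = D_0`.
* (iii) **`AnalyticLamConstValDivisorSet W p S`** (TYPED, §2): for every `Λ`-factorisation
  `ι(g·h) = ϖ·L_p(f,α)` (Néron normalisation of `X1/MuLambda.lean`), `(λ(g), v_p(g(0))) ∈ S`.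
  CERTIFICATE (outside the kernel, exact): by Weierstrass preparation and unique factorisation
  `g = u · p^{μ'} · D` with `D` a monic divisor of the analytic distinguished polynomial `P_an` and
  `μ' ≤ μ_an`, so `(λ(g), v_p(g(0))) = (deg D, μ' + Σ_{Q ∣ D} deg Q · s_Q)` over the `ℚ_p`-irreducible
  factors `Q` of `P_an` with root valuation `s_Q` (Newton polygon + Ore; route N's two engines).
* KERNEL (§3–§4): at a good ordinary Eisenstein pair with `L(E,1) ≠ 0`, every divisor `g` of the
  analytic function has `g(0) ≠ 0` (interpolation: `c₀(ϖ·L_p) = ϖ(1 − α⁻¹)² L(E,1)/Ω⁺_f ≠ 0`,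
  `constantCoeff_ne_zero_of_factorisation`); for the characteristic power series `g = f_E` of a
  dual datum (Wuthrich Thm. 16: `f_E ∣ ϖ·L_p`), LEMMA M₀ + `NoFiniteSubmoduleAt` give
  `p^B ≤ #(X/𝔪X) ≤ p^{v_p(f_E(0))}`, so `(λ_alg, v) ∈ S` for some `v ≥ B`:
  **`AlgebraicLambdaMem W p {d | ∃ v, (d, v) ∈ S ∧ B ≤ v}`** (`AlgebraicLambdaMem.of_generatorCount`),
  whence `BSD(E,p)` on the leaf by gen 12's squeeze (`Leaf.bsdp_of_muZero_of_generatorCount`, and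
  `…_of_prop414` discharging `NoFiniteSubmoduleAt` BY NAME from Greenberg Prop. 4.14 on members with
  `p ∤ #E(ℚ)_tors`).

CENSUS (gen 13, `HOME/b2b-bsdres-eisenstein-p1/routeM/routeM13.py`, exact, seconds; X1R0-GAPMAP
§22): of the route-M closures of record beyond routes N/N∘C (gen 12: window `N < 2·10⁴` 14 + M∘C 1,
lane N1″ 3 + M∘C 1, `p = 3` beyond the window 230 + M∘C 1 (ROUTE-NB fold) and 180 (NB-2)), the
layer-0 kernel form with the count of a SINGLE member reproduces ALL but 7, all in NB-2
(`32042b, 92759c, 131366a, 222338f, 262946c, 282310u @3`: the count binds at LAYER 1;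
`356590s@3`: an atom of slope `3/2`, where `v_p(Q(0)) = 3 > 2 = ord_𝔪(Q)`); those 7 keep the
paper LEMMA (M); 0 violations (the full product is admissible at every member). EXAMPLE `258f1@7`: `λ_an = 6`, `P_an = Q₂·Q₄` (root valuations `1/2`, `1/4`),
`μ_an = 0`, so `S = {(0,0), (2,1), (4,1), (6,2)}`; `B = 2` (`7`-torsion, two split primes with
`7 ∣ c_ℓ`); `{d | ∃ v ≥ 2, (d,v) ∈ S} = {6}`: `λ_alg = 6`.

References: [GreenbergLNM1716] Prop. 3.10, Thm. 4.1, Prop. 4.14, §4 Lemma 4.2, p. 137;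
[Wuthrich2014] Thm. 16; [HachimoriMatsuno2000] Cor. (i); X1R0-GAPMAP §14.1, §21, §22.
-/

noncomputable section

open scoped Classical MatrixGroups ModularForm

open PowerSeries CongruenceSubgroup WeierstrassCurve Literature.NumberTheory.EllipticCurves
  Literature.NumberTheory.EllipticCurves.ModularForms
  Literature.NumberTheory.EllipticCurves.Rank1Residual
  Literature.NumberTheory.EllipticCurves.Greenberg1999
  Literature.NumberTheory.EllipticCurves.IwasawaAlgebra
  Summit.BirchSwinnertonDyer.BirchSwinnertonDyer.Theorems.Rank1ResidualX1Defs
  Summit.BirchSwinnertonDyer.Rank1Residual.X1.MuLambda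
  Summit.BirchSwinnertonDyer.Rank1Residual.X1.MuPart
  Summit.BirchSwinnertonDyer.Rank1Residual.X1.ParitySqueeze
  Summit.BirchSwinnertonDyer.Rank1Residual.X1.TamagawaSqueeze
  Summit.BirchSwinnertonDyer.Rank1Residual.X1.FactorSqueeze
  Summit.BirchSwinnertonDyer.Rank1Residual.X1.GeneratorSqueeze
  Summit.BirchSwinnertonDyer.Rank1Residual.Additive

set_option autoImplicit false

namespace Summit.BirchSwinnertonDyer.Rank1Residual.X1.GeneratorCountSqueeze

/-! ## §1. "`X(E/ℚ_∞)` needs at least `B` generators", TYPED (count form; nothing asserted) -/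

/-- **"`p^B ≤ #(X/𝔪X)`" (TYPED; nothing asserted):** for the cyclotomic `ℤ_p`-extension `κ` with
topological generator `γ` (a cyclotomic variable) and every Pontryagin-dual Selmer datum `D` of `W`
whose module `X = D.X` is `Λ`-torsion, `p^B ≤ #(X/𝔪X)` with `𝔪 = (p, T)` the maximal ideal of
`Λ = ℤ_p⟦T⟧` — i.e. `X` needs at least `B` generators (Nakayama), i.e. `dim_{𝔽_p} Sel_E(ℚ_∞)[p]^Γ ≥ B`
(`X/𝔪X` is dual to `Sel^Γ[p]`). ROUTE T's count (X1R0-GAPMAP §14.1 (a)–(f), the step BEFORE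
Greenberg's inequality `λ + μ ≥ dim X/𝔪X`, LNM 1716 p. 137): `B = t_0(E) + a − 2δ` with `t_0` the
number of bad `ℓ` with `p ∣ c_ℓ(E)`, `a ∈ {1, 2}` the `p`-rank of the local norm cokernel at `p`,
`δ = [E(ℚ)[p] ≠ 0]`; ROUTE D's (§17.1): `B = D_0`. Certified per pair OUTSIDE the kernel.
`B = 0` always qualifies. [cite: GreenbergLNM1716, p. 137 (shape only; nothing asserted)] -/
def GeneratorCountGE (W : WeierstrassCurve ℚ) [W.IsElliptic] [W.IsGloballyMinimal] (p : ℕ)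
    [Fact p.Prime] (B : ℕ) : Prop :=
  ∀ (κ : ZpExtension ℚ p) (γ : Field.absoluteGaloisGroup ℚ),
      κ.IsCyclotomic → κ.IsTopGenerator γ → IsCyclotomicVariable p γ →
    ∀ (D : W.SelmerDualData κ γ) [Module.Finite (IwasawaAlgebra p) D.X], D.IsTorsion →
      p ^ B ≤ Nat.card (D.X ⧸ IsLocalRing.maximalIdeal (IwasawaAlgebra p) •
        (⊤ : Submodule (IwasawaAlgebra p) D.X))

/-! ## §2. "every `Λ`-divisor `g` of `ϖ·L_p(E,T)` has `(λ(g), v_p(g(0))) ∈ S`", TYPED -/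

/-- **"`(λ(g), v_p(g(0))) ∈ S` for every `Λ`-divisor `g` of `ϖ·L_p(E,T)`" (TYPED; nothing asserted).**
For the newform `f` of `E`, every rational `ϖ` with `ϖ·Ω_E = Ω⁺_f` (Néron normalisation of
`X1/MuLambda.lean`) and all `g, h ∈ Λ` with `ι(g·h) = ϖ·L_p(f,α)`: `(λ(g), v_p(g(0))) ∈ S`
(`v_p` = `PadicInt.valuation`, junk `0` at `g(0) = 0`, which does not occur when `L(E,1) ≠ 0`,
`constantCoeff_ne_zero_of_factorisation`). CERTIFICATE (outside the kernel): `g = u·p^{μ'}·D`, `D` a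
monic divisor of the analytic distinguished polynomial, so `S ⊇ {(deg D, μ' + v_p(D(0)))}`, read off
the Newton polygon of `ϖ·L_p` (route N's atoms with slopes). `S = univ` always qualifies. The route-N
input `AnalyticLamDivisorSet W p A` is the projection `S = A × univ`.
[cite: Washington1997, Thm. 7.3 and Prop. 7.6 (shape only; nothing asserted)] -/
def AnalyticLamConstValDivisorSet (W : WeierstrassCurve ℚ) [W.IsElliptic] [W.IsGloballyMinimal]
    (p : ℕ) [Fact p.Prime] (S : Set (ℕ × ℕ)) : Prop :=
  ∀ [NeZero (W.conductorNorm ℤ)] (f : CuspForm (Gamma0 (W.conductorNorm ℤ)) 2),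
    IsNewformOf W f → ∀ (ϖ : ℚ), (ϖ : ℝ) * W.realPeriodRat = plusPeriod f →
    ∀ (g h : IwasawaAlgebra p),
      iwasawaToPowerSeries p (g * h) = C (ϖ : ℚ_[p]) * padicLFunction f (unitRoot W p : ℚ_[p]) →
      (lam g, (constantCoeff g).valuation) ∈ S

section Basic

variable {W : WeierstrassCurve ℚ} [W.IsElliptic] [W.IsGloballyMinimal] {p : ℕ} [Fact p.Prime]

/-- `GeneratorCountGE` is antitone in the count. [folklore] -/
theorem GeneratorCountGE.mono {B B' : ℕ} (hBB' : B' ≤ B) (hB : GeneratorCountGE W p B) :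
    GeneratorCountGE W p B' :=
  fun κ γ hκ hγ hγ' D _ hX ↦
    (Nat.pow_le_pow_right (Nat.Prime.pos Fact.out) hBB').trans (hB κ γ hκ hγ hγ' D hX)

omit [W.IsElliptic] [W.IsGloballyMinimal] in
/-- The trivial count `B = 0` (`X/𝔪X` is finite for `X` finitely generated, being a finitely
generated module over the finite field `Λ/𝔪`). [folklore] -/
theorem generatorCountGE_zero (W : WeierstrassCurve ℚ) [W.IsElliptic] [W.IsGloballyMinimal]
    (p : ℕ) [Fact p.Prime] : GeneratorCountGE W p 0 := by
  intro κ γ _ _ _ D _ _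
  haveI : Finite (D.X ⧸ IsLocalRing.maximalIdeal (IwasawaAlgebra p) •
      (⊤ : Submodule (IwasawaAlgebra p) D.X)) := by
    haveI := finite_quotient_maximalIdeal p
    exact Module.finite_of_finite (IwasawaAlgebra p ⧸ IsLocalRing.maximalIdeal (IwasawaAlgebra p))
      (M := D.X ⧸ IsLocalRing.maximalIdeal (IwasawaAlgebra p) •
        (⊤ : Submodule (IwasawaAlgebra p) D.X))
  rw [pow_zero]
  exact Nat.one_le_iff_ne_zero.mpr Nat.card_pos.ne'

/-- `AnalyticLamConstValDivisorSet` is monotone in the set. [folklore] -/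
theorem AnalyticLamConstValDivisorSet.mono {S S' : Set (ℕ × ℕ)} (hSS' : S ⊆ S')
    (hS : AnalyticLamConstValDivisorSet W p S) : AnalyticLamConstValDivisorSet W p S' :=
  fun f hf ϖ hϖ g h hι ↦ hSS' (hS f hf ϖ hϖ g h hι)

omit [W.IsElliptic] [W.IsGloballyMinimal] in
/-- The trivial certificate `S = univ`. [folklore] -/
theorem analyticLamConstValDivisorSet_univ (W : WeierstrassCurve ℚ) [W.IsElliptic]
    [W.IsGloballyMinimal] (p : ℕ) [Fact p.Prime] : AnalyticLamConstValDivisorSet W p Set.univ :=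
  fun _ _ _ _ _ _ _ ↦ Set.mem_univ _

/-- **Route N's input is the projection**: `AnalyticLamConstValDivisorSet W p S` gives
`AnalyticLamDivisorSet W p (Prod.fst '' S)`. [folklore] -/
theorem AnalyticLamConstValDivisorSet.analyticLamDivisorSet_image_fst {S : Set (ℕ × ℕ)}
    (hS : AnalyticLamConstValDivisorSet W p S) : AnalyticLamDivisorSet W p (Prod.fst '' S) :=
  fun f hf ϖ hϖ g h hι ↦ ⟨_, hS f hf ϖ hϖ g h hι, rfl⟩

end Basic

/-! ## §3. At `L(E,1) ≠ 0` every divisor of the analytic function has nonzero constant term -/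

section ConstantTerm

variable {W : WeierstrassCurve ℚ} [W.IsElliptic] [W.IsGloballyMinimal] {p : ℕ} [Fact p.Prime]

/-- **`g(0) ≠ 0` for every `Λ`-divisor `g` of `ϖ·L_p(E,T)` when `L(E,1) ≠ 0`** (good ordinary `p`):
the constant term of `ϖ·L_p(f,α)` is `ϖ·(1 − α⁻¹)²·[0]⁺_f` (interpolation,
`constantCoeff_padicLFunction_unitRoot`) with `ϖ ≠ 0`, `1 − α⁻¹ ∼ #Ẽ(𝔽_p)(p) ≠ 0` and
`[0]⁺_f = L(E,1)/Ω⁺_f ≠ 0`. [cite: MazurTateTeitelbaum1986Invent, §I.14 (14.3)] -/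
theorem constantCoeff_ne_zero_of_factorisation (hgood : W.HasGoodReductionAtPrime p)
    (hord : ¬ (p : ℤ) ∣ W.frobeniusTrace p) (hL : W.entireLFunction 1 ≠ 0)
    [NeZero (W.conductorNorm ℤ)] {f : CuspForm (Gamma0 (W.conductorNorm ℤ)) 2}
    (hf : IsNewformOf W f) {ϖ : ℚ} (hϖ : (ϖ : ℝ) * W.realPeriodRat = plusPeriod f)
    {g h : IwasawaAlgebra p}
    (hι : iwasawaToPowerSeries p (g * h) = C (ϖ : ℚ_[p]) * padicLFunction f (unitRoot W p : ℚ_[p])) :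
    constantCoeff g ≠ 0 := by
  have hpP : p.Prime := Fact.out
  have hordp : IsOrdinaryAt W p := ⟨hgood, hord⟩
  set a : ℚ_[p] := ((unitRoot W p : ℤ_[p]) : ℚ_[p]) with ha
  set s : ℚ := ratPlusSymbol f 0 with hs_def
  have hs0 : s ≠ 0 := by
    intro h0
    apply hL
    rw [hf.entireLFunction_one_eq, ← hs_def, h0]
    simp
  have hϖ0 : ϖ ≠ 0 := varpi_ne_zero hf hϖ
  have hg0c : ((constantCoeff (g * h) : ℤ_[p]) : ℚ_[p]) =
      (ϖ : ℚ_[p]) * ((1 - a⁻¹) ^ 2 * (s : ℚ_[p])) := by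
    rw [← constantCoeff_iwasawaToPowerSeries p (g * h), hι, map_mul, constantCoeff_C,
      constantCoeff_padicLFunction_unitRoot hordp hf]
  obtain ⟨u₂, hu₂⟩ := exists_unit_one_sub_unitRoot_inv p W hordp
  haveI : NeZero p := ⟨hpP.ne_zero⟩
  obtain ⟨u₃, hu₃⟩ := exists_unit_natCard_eq_mul_card_primaryComponent
    ((integralModelInt W).map (Int.castRingHom (ZMod p))).toAffine.Point p
  set Np : ℚ_[p] := (Nat.card (AddCommGroup.primaryComponent
    ((integralModelInt W).map (Int.castRingHom (ZMod p))).toAffine.Point p) : ℚ_[p]) with hNp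
  have hNcount : (W.reductionPointCount p : ℚ_[p]) = ((u₃ : ℤ_[p]) : ℚ_[p]) * Np := by
    rw [WeierstrassCurve.reductionPointCount, hNp]
    exact hu₃
  have hNp0 : Np ≠ 0 := by rw [hNp]; exact_mod_cast Nat.card_pos.ne'
  have h1 : (1 - a⁻¹) = ((u₂ : ℤ_[p]) : ℚ_[p]) * ((u₃ : ℤ_[p]) : ℚ_[p]) * Np := by
    rw [hu₂, hNcount, mul_assoc]
  have h1ne : (1 - a⁻¹) ≠ 0 := by
    rw [h1]
    exact mul_ne_zero (mul_ne_zero (coe_units_ne_zero p u₂) (coe_units_ne_zero p u₃)) hNp0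
  have hgh00 : constantCoeff (g * h) ≠ 0 := by
    intro h0
    rw [h0, PadicInt.coe_zero] at hg0c
    have : (ϖ : ℚ_[p]) * ((1 - a⁻¹) ^ 2 * (s : ℚ_[p])) ≠ 0 :=
      mul_ne_zero (by exact_mod_cast hϖ0) (mul_ne_zero (pow_ne_zero 2 h1ne) (by exact_mod_cast hs0))
    exact this hg0c.symm
  intro h0; apply hgh00; rw [map_mul, h0, zero_mul]

end ConstantTerm

/-! ## §4. The kernel squeeze: count + Newton data + LEMMA M₀ ⇒ `λ_alg ∈ A` ⇒ `BSD(E,p)` -/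

section Squeeze

variable {W : WeierstrassCurve ℚ} [W.IsElliptic] [W.IsGloballyMinimal] {p : ℕ} [Fact p.Prime]

/-- **ROUTE M IN THE KERNEL (layer 0): `λ_alg ∈ {d | ∃ v ≥ B, (d, v) ∈ S}`.** `W/ℚ` globally minimal
elliptic, `p ≠ 2` good ordinary with `E[p]` reducible, `L(E,1) ≠ 0`; granted Wuthrich 2014 Thm. 16
(`hW16`) and modularity (`hmod`), both PUBLISHED: if `X(E/ℚ_∞)` has no nonzero finite `Λ`-submodule
(`NoFiniteSubmoduleAt p W`, typed; Greenberg Prop. 4.14/4.15), needs at least `B` generators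
(`GeneratorCountGE W p B`, typed) and the divisors of `ϖ·L_p` have Newton data in `S`
(`AnalyticLamConstValDivisorSet W p S`, typed), then `AlgebraicLambdaMem W p {d | ∃ v, (d,v) ∈ S ∧ B ≤ v}`:
for a dual datum with `char X = (f_E)`, `f_E·h = ` the analytic function (Thm. 16), `f_E(0) ≠ 0`
(§3), LEMMA M₀ (`GeneratorBound.natCard_quotient_maximalIdeal_le`) gives
`p^B ≤ #(X/𝔪X) ≤ p^{v_p(f_E(0))}`, and `(λ(f_E), v_p(f_E(0))) ∈ S` with `λ(f_E) = λ(X)`.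
[cite: GreenbergLNM1716, §4 Lemma 4.2, p. 137] [cite: Wuthrich2014, Thm. 16 (p. 397)] -/
theorem AlgebraicLambdaMem.of_generatorCount
    (hW16 : Wuthrich2014.charIdeal_dvd_padicLFunction) (hmod : nonempty_modularParametrizationData)
    (hp : p ≠ 2) (hgood : W.HasGoodReductionAtPrime p) (hord : ¬ (p : ℤ) ∣ W.frobeniusTrace p)
    (hred : ¬ W.HasIrreducibleModPGaloisRep p) (hL : W.entireLFunction 1 ≠ 0)
    (hnf : NoFiniteSubmoduleAt p W) {B : ℕ} {S : Set (ℕ × ℕ)} (hB : GeneratorCountGE W p B)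
    (hS : AnalyticLamConstValDivisorSet W p S) :
    AlgebraicLambdaMem W p {d | ∃ v, (d, v) ∈ S ∧ B ≤ v} := by
  intro κ γ hκ hγ hγ' D _ hXt
  haveI : NeZero (W.conductorNorm ℤ) := ⟨(W.conductorNorm_pos_holds).ne'⟩
  obtain ⟨hX, f, ϖ, g, h, hf, hϖ, hchar, hι⟩ :=
    isTorsion_and_exists_factorisation hW16 hmod hp hgood hord hred hκ hγ hγ' D
  have hg0 : constantCoeff g ≠ 0 := constantCoeff_ne_zero_of_factorisation hgood hord hL hf hϖ hι
  have hgne : g ≠ 0 := fun h0 ↦ hg0 (by rw [h0, map_zero])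
  have hlam : lam g = lambdaInvariant p D.X := lam_generator_eq_lambdaInvariant D.X hX hgne hchar
  have hXtors : Module.IsTorsion (IwasawaAlgebra p) D.X := hX
  obtain ⟨-, hle⟩ := GeneratorBound.natCard_quotient_maximalIdeal_le D.X hXtors
    (hnf hκ hγ hγ' D hX) g hchar hg0
  have hBv : B ≤ (constantCoeff g).valuation :=
    (Nat.pow_le_pow_iff_right (Nat.Prime.one_lt Fact.out)).mp ((hB κ γ hκ hγ hγ' D hX).trans hle)
  exact ⟨(constantCoeff g).valuation, hlam ▸ hS f hf ϖ hϖ g h hι, hBv⟩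

/-- **On the leaf X1 ∩ {r = 0}: `μ_an = 0 ∧ λ_an = n ∧ (count B) ∧ (Newton data S) ∧ gap ⇒ BSD(E,p)`**
— route M's closures re-derived with LEMMA M₀ INSIDE the kernel: the typed inputs are now the
generator count `GeneratorCountGE W p B` (route T's §14.1 count / route D's `D_0`) and the analytic
Newton data `AnalyticLamConstValDivisorSet W p S`; the gap check is `∀ (d,v) ∈ S, B ≤ v → Even d →
d ≤ n → n ≤ d + 1`. `NoFiniteSubmoduleAt p W` stays typed here (Greenberg Prop. 4.15 for good
ordinary `p` odd over `ℚ`; Prop. 4.14 BY NAME when `p ∤ #E(ℚ)_tors`, next theorem). EXAMPLE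
`258f1@7`: `n = 6`, `B = 2`, `S = {(0,0),(2,1),(4,1),(6,2)}`. Facts `hW16`, `hGr`, `h310`, `hmod`,
`hGZK` PUBLISHED. [cite: GreenbergLNM1716, Prop. 3.10, Thm. 4.1, §4 Lemma 4.2, p. 137]
[cite: Wuthrich2014, Thm. 16 (p. 397)] -/
theorem Leaf.bsdp_of_muZero_of_generatorCount
    (hW16 : Wuthrich2014.charIdeal_dvd_padicLFunction) (hGr : greenberg_charValue_rankZero)
    (h310 : prop310_selmerCorank_mod_two_eq_lambdaInvariant)
    (hmod : nonempty_modularParametrizationData)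
    (hGZK : rank_eq_analyticRank_of_analyticRank_le_one) (hL : RankZero.Leaf W p)
    (hnf : NoFiniteSubmoduleAt p W) (hμ0 : AnalyticMuLE W p 0) {n B : ℕ} {S : Set (ℕ × ℕ)}
    (hlam : AnalyticLambdaEq W p n) (hB : GeneratorCountGE W p B)
    (hS : AnalyticLamConstValDivisorSet W p S)
    (hgap : ∀ d v, (d, v) ∈ S → B ≤ v → Even d → d ≤ n → n ≤ d + 1) : BSDp W p :=
  have hX := isClassX1_of_classX1 hL.classX1
  GeneratorSqueeze.Leaf.bsdp_of_muZero_of_lambdaMem hW16 hGr h310 hmod hGZK hL hμ0 hlam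
    (AlgebraicLambdaMem.of_generatorCount hW16 hmod hX.two_ne hX.hasGoodReductionAtPrime
      hX.not_dvd_frobeniusTrace hX.not_hasIrreducibleModPGaloisRep
      (entireLFunction_one_ne_zero_of_analyticRank_eq_zero hmod W hL.analyticRank_eq_zero) hnf hB hS)
    fun d ⟨v, hv, hBv⟩ ↦ hgap d v hv hBv

/-- **The same with `NoFiniteSubmoduleAt` discharged BY NAME from Greenberg 1999 Prop. 4.14
(= Hachimori–Matsuno 2000 Cor. (i)) on members with `p ∤ #E(ℚ)_tors`** (`h414` PUBLISHED; n1011's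
`Additive.noFiniteSubmoduleAt_of_prop414`) — the typical binding member of the census: the `μ = 0`
member without rational `p`-torsion, `B = t_0 + 2`. [cite: GreenbergLNM1716, Prop. 3.10, Thm. 4.1,
Prop. 4.14, p. 137] [cite: HachimoriMatsuno2000, Corollary (i)] [cite: Wuthrich2014, Thm. 16 (p. 397)] -/
theorem Leaf.bsdp_of_muZero_of_generatorCount_of_prop414
    (hW16 : Wuthrich2014.charIdeal_dvd_padicLFunction) (hGr : greenberg_charValue_rankZero)
    (h310 : prop310_selmerCorank_mod_two_eq_lambdaInvariant)
    (h414 : prop414_noFiniteSubmodule_of_not_dvd_torsionOrder)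
    (hmod : nonempty_modularParametrizationData)
    (hGZK : rank_eq_analyticRank_of_analyticRank_le_one) (hL : RankZero.Leaf W p)
    (htors : ¬ p ∣ W.torsionOrder) (hμ0 : AnalyticMuLE W p 0) {n B : ℕ} {S : Set (ℕ × ℕ)}
    (hlam : AnalyticLambdaEq W p n) (hB : GeneratorCountGE W p B)
    (hS : AnalyticLamConstValDivisorSet W p S)
    (hgap : ∀ d v, (d, v) ∈ S → B ≤ v → Even d → d ≤ n → n ≤ d + 1) : BSDp W p :=
  Leaf.bsdp_of_muZero_of_generatorCount hW16 hGr h310 hmod hGZK hL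
    (noFiniteSubmoduleAt_of_prop414 h414 htors) hμ0 hlam hB hS hgap

/-- **Two certificates intersected (the M₀ ∘ C shape, e.g. `7154c@3`, `149170d@3`):** the kernel
count certificate `{d | ∃ v ≥ B, (d,v) ∈ S}` together with any other membership certificate
`AlgebraicLambdaMem W p A'` (route C's cyclotomic factor, route N, route D) and the gap check on the
intersection give `BSD(E,p)` on the leaf. [cite: GreenbergLNM1716, Prop. 3.10, Thm. 4.1, pp. 132, 137]
[cite: Wuthrich2014, Thm. 16 (p. 397)] -/
theorem Leaf.bsdp_of_muZero_of_generatorCount_inter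
    (hW16 : Wuthrich2014.charIdeal_dvd_padicLFunction) (hGr : greenberg_charValue_rankZero)
    (h310 : prop310_selmerCorank_mod_two_eq_lambdaInvariant)
    (hmod : nonempty_modularParametrizationData)
    (hGZK : rank_eq_analyticRank_of_analyticRank_le_one) (hL : RankZero.Leaf W p)
    (hnf : NoFiniteSubmoduleAt p W) (hμ0 : AnalyticMuLE W p 0) {n B : ℕ} {S : Set (ℕ × ℕ)}
    {A' : Set ℕ} (hlam : AnalyticLambdaEq W p n) (hB : GeneratorCountGE W p B)
    (hS : AnalyticLamConstValDivisorSet W p S) (hA' : AlgebraicLambdaMem W p A')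
    (hgap : ∀ d v, (d, v) ∈ S → B ≤ v → d ∈ A' → Even d → d ≤ n → n ≤ d + 1) : BSDp W p :=
  have hX := isClassX1_of_classX1 hL.classX1
  GeneratorSqueeze.Leaf.bsdp_of_muZero_of_lambdaMem_inter hW16 hGr h310 hmod hGZK hL hμ0 hlam
    (AlgebraicLambdaMem.of_generatorCount hW16 hmod hX.two_ne hX.hasGoodReductionAtPrime
      hX.not_dvd_frobeniusTrace hX.not_hasIrreducibleModPGaloisRep
      (entireLFunction_one_ne_zero_of_analyticRank_eq_zero hmod W hL.analyticRank_eq_zero) hnf hB hS) hA'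
    fun d ⟨v, hv, hBv⟩ hd ↦ hgap d v hv hBv hd

end Squeeze

end Summit.BirchSwinnertonDyer.Rank1Residual.X1.GeneratorCountSqueeze

end
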